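import Literature.LinearAlgebra.TensorNetworks.JunctionTree
import Literature.Combinatorics.SimpleGraph.TreewidthApproximation
import Mathlib.Algebra.Tropical.BigOperators
import HarnessLib

/-!
# The separator oracle of the Robertson–Seymour procedure as a min-plus dynamic programme

Topic `Literature/Combinatorics/SimpleGraph`, sequel of `TreewidthApproximation.lean` (the
procedure over an abstract oracle `oracle S forced`, specified by `OracleSound` /
`OracleComplete`) and client of `Literature/LinearAlgebra/TensorNetworks/JunctionTree.lean`
(junction-tree evaluation of a list network over any commutative semiring, `JT.dpValue_eq_netValue`).

A minimum vertex separator between two vertex sets is classically found by a max-flow computation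
(Menger's theorem; this is how Cygan et al., Thm. 7.18, and Robertson–Seymour find the separator).
Here it is found WITHOUT flows, by dynamic programming over an auxiliary tree decomposition of the
whole graph — the "iterative compression" device of Bodlaender's and Korhonen's algorithms: the
question "label the vertices by `0` (side `A`), `1` (separator), `2` (side `B`) so that the forced
labels are respected and no edge joins a `0` to a `2`, minimising the number of `1`s in `S`" is a
sum-of-products problem over the min-plus (tropical) semiring `Tropical (WithTop ℕ)` whose primal
graph is the graph itself, so the junction-tree algorithm over any tree decomposition of width `w`
answers it exactly at cost `3^{w+1} · poly`; an optimal labeling is then extracted by self-reduction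
(fix the labels of the vertices of `S` one at a time, keeping the optimum).

* `SepFactor`, `unNat`/`UnOK`/`BinOK`, `sepOps S forced`, `sepFactors nv edges`, `SepCtx`
  (vertices `< nv`, the edge list, an auxiliary rooted decomposition in list form, the enumeration
  budget), `SepCtx.Valid`, `sepMin` (the DP value, a `WithTop ℕ`), `costOf`/`natCost`/`OK`
  (the cost of a labeling: the number of separator vertices of `S`, or `⊤` if a forced label or an
  edge constraint is violated), **`sepMin_eq_inf`** (`sepMin` is the minimum cost);
* `chooseLabel`, `extendAll`, `sepOracle C k` and **`sepOracle_sound`**, **`sepOracle_complete`**: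
  over a valid context the oracle is sound and complete in the sense of `TreewidthApproximation.lean`
  for the edge relation `edgeRel C.edges` and `S₀ = [0, …, nv-1]`.

## References

* M. Cygan et al., *Parameterized Algorithms*, Springer 2015, Thm. 7.18 (the separator step) and
  §7.3 (dynamic programming over tree decompositions, e.g. Thm. 7.9–7.10: local constraints cost
  `c^{w} · n`).
* R. Dechter, Artif. Intell. 113 (1999), §6 (optimisation tasks — min-sum — by bucket elimination).
* T. Korhonen, *A single-exponential time 2-approximation algorithm for treewidth*, FOCS 2021, §1
  (improving a decomposition by separators computed by DP over the decomposition itself).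
-/

namespace Literature.Combinatorics.SimpleGraph

namespace ListTD

open Finset Tropical Literature.LinearAlgebra.TensorNetworks Literature.LinearAlgebra.TensorNetworks.JT

/-! ### The labeling problem as a min-plus network -/

/-- **Factor symbols**: a unary constraint at a vertex, a binary constraint at an edge. [folklore] -/
inductive SepFactor
  /-- the unary factor of the vertex `v` -/
  | un (v : ℕ)
  /-- the binary factor of the edge `(u, v)` -/
  | bin (u v : ℕ)

/-- **The separator count** of a vertex: `1` if it lies in `S` and is labeled `1`. [folklore] -/
def unNat (S : List ℕ) (v l : ℕ) : ℕ := if v ∈ S ∧ l = 1 then 1 else 0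

/-- **The forced labels are respected** at `v`. [folklore] -/
def UnOK (forced : List (ℕ × ℕ)) (v l : ℕ) : Prop := ∀ q ∈ forced, q.1 = v → l = q.2

/-- `UnOK` is decidable. [folklore] -/
instance (forced : List (ℕ × ℕ)) (v l : ℕ) : Decidable (UnOK forced v l) := by
  unfold UnOK; infer_instance

/-- **The edge constraint**: inside `S`, no edge from label `0` to label `2` (either way). [cite: CyganEtAl2015, Thm 7.18 (the separation (A, B) of S)] -/
def BinOK (S : List ℕ) (u v lu lv : ℕ) : Prop := ¬ (u ∈ S ∧ v ∈ S ∧ ((lu = 0 ∧ lv = 2) ∨ (lu = 2 ∧ lv = 0)))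

/-- `BinOK` is decidable. [folklore] -/
instance (S : List ℕ) (u v lu lv : ℕ) : Decidable (BinOK S u v lu lv) := by
  unfold BinOK; infer_instance

/-- **The factors over the tropical semiring** `Tropical (WithTop ℕ)` (`+` = `min`, `·` = `+`):
unary `[v ∈ S ∧ l = 1] + (0 if the forced labels are respected, else ⊤)`, binary
`(0 if the edge constraint holds, else ⊤)`. [cite: Dechter1999, §6 (min-sum problems as bucket elimination)] -/
def sepOps (S : List ℕ) (forced : List (ℕ × ℕ)) : FactorOps (Tropical (WithTop ℕ)) SepFactor where
  scope
    | .un v => [v]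
    | .bin u v => [u, v]
  feval
    | .un v => fun a => trop (((unNat S v (a v) : ℕ) : WithTop ℕ) + (if UnOK forced v (a v) then 0 else ⊤))
    | .bin u v => fun a => trop (if BinOK S u v (a u) (a v) then 0 else ⊤)

/-- **The factor list**: one unary factor per vertex `< nv`, one binary factor per listed edge.
[folklore] -/
def sepFactors (nv : ℕ) (edges : List (ℕ × ℕ)) : List SepFactor :=
  (List.range nv).map SepFactor.un ++ edges.map fun e => SepFactor.bin e.1 e.2

/-- **The static data of the oracle**: the number of vertices, the enumeration budget, the edge
list, and an auxiliary rooted tree decomposition (list form) of the whole graph. [folklore] -/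
structure SepCtx where
  /-- vertices are `0, …, nv - 1` -/
  nv : ℕ
  /-- enumeration budget of the dynamic programme -/
  cap : ℕ
  /-- the edges -/
  edges : List (ℕ × ℕ)
  /-- parents of the auxiliary decomposition -/
  par : List ℕ
  /-- bags of the auxiliary decomposition -/
  bags : List (List ℕ)

/-- **Validity of the static data**: the auxiliary decomposition is a rooted tree decomposition
of the vertices `< nv` covering the listed edges (whose ends are vertices), and the budget allows
the enumeration of the `3^{|bag|}` labelings of every bag. [folklore] -/
structure SepCtx.Valid (C : SepCtx) : Prop where
  /-- the auxiliary decomposition is valid -/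
  td : IsRootedTD C.nv C.par C.bags
  /-- edges join vertices and lie in bags -/
  edges : ∀ e ∈ C.edges, e.1 < C.nv ∧ e.2 < C.nv ∧ ∃ t, t < C.bags.length ∧ e.1 ∈ bagOf C.bags t ∧ e.2 ∈ bagOf C.bags t
  /-- the budget suffices -/
  cap : ∀ t, t < C.bags.length → 3 ^ (bagOf C.bags t).length ≤ C.cap

/-- **The edge relation of an edge list** (both orientations). [folklore] -/
def edgeRel (edges : List (ℕ × ℕ)) (u v : ℕ) : Prop := (u, v) ∈ edges ∨ (v, u) ∈ edges

/-- The edge relation is symmetric. [folklore] -/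
theorem edgeRel_symm (edges : List (ℕ × ℕ)) : ∀ u v, edgeRel edges u v → edgeRel edges v u :=
  fun _ _ h => h.symm

/-- **The DP value**: the junction-tree evaluation of the min-plus network along the auxiliary
decomposition. [cite: Dechter1999, §6] -/
noncomputable def sepMin (C : SepCtx) (S : List ℕ) (forced : List (ℕ × ℕ)) : WithTop ℕ :=
  untrop (dpValue (sepOps S forced) 3 C.cap C.par C.bags (sepFactors C.nv C.edges))

/-! ### The cost of a labeling -/

/-- **All constraints hold** for the labeling `a`. [folklore] -/
def OK (C : SepCtx) (S : List ℕ) (forced : List (ℕ × ℕ)) (a : ℕ → ℕ) : Prop :=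
  (∀ v, v < C.nv → UnOK forced v (a v)) ∧ ∀ e ∈ C.edges, BinOK S e.1 e.2 (a e.1) (a e.2)

/-- **The number of separator vertices of `S`** under the labeling `a` (counted over the
vertices `< nv`). [folklore] -/
def natCost (C : SepCtx) (S : List ℕ) (a : ℕ → ℕ) : ℕ := ((List.range C.nv).map fun v => unNat S v (a v)).sum

/-- **The cost of a labeling**: the sum of the (untropicalised) factor values. [folklore] -/
noncomputable def costOf (C : SepCtx) (S : List ℕ) (forced : List (ℕ × ℕ)) (a : ℕ → ℕ) : WithTop ℕ :=
  ((sepFactors C.nv C.edges).map fun φ => untrop ((sepOps S forced).feval φ a)).sum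

/-- A list of extended naturals sums to `⊤` iff some term is `⊤`. [folklore] -/
theorem list_sum_eq_top_iff : ∀ l : List (WithTop ℕ), l.sum = ⊤ ↔ ⊤ ∈ l
  | [] => by simp
  | x :: l => by rw [List.sum_cons, WithTop.add_eq_top, list_sum_eq_top_iff l, List.mem_cons, eq_comm]

open scoped Classical in
/-- **The cost is the separator count if all constraints hold, and `⊤` otherwise.** [folklore] -/
theorem costOf_eq (C : SepCtx) (S : List ℕ) (forced : List (ℕ × ℕ)) (a : ℕ → ℕ) :
    costOf C S forced a = if OK C S forced a then ((natCost C S a : ℕ) : WithTop ℕ) else ⊤ := by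
  unfold costOf sepFactors
  rw [List.map_append, List.map_map, List.map_map, List.sum_append]
  split_ifs with hok
  · -- every term is finite
    have h1 : ((List.range C.nv).map ((fun φ => untrop ((sepOps S forced).feval φ a)) ∘ SepFactor.un)).sum =
        ((natCost C S a : ℕ) : WithTop ℕ) := by
      rw [natCost, Nat.cast_list_sum, List.map_map]
      congr 1
      refine List.map_congr_left fun v hv => ?_
      simp only [Function.comp_apply, sepOps, untrop_trop, if_pos (hok.1 v (List.mem_range.1 hv)), add_zero]
    have h2 : (C.edges.map ((fun φ => untrop ((sepOps S forced).feval φ a)) ∘ fun e => SepFactor.bin e.1 e.2)).sum = 0 := by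
      rw [List.sum_eq_zero]
      intro x hx
      obtain ⟨e, he, rfl⟩ := List.mem_map.1 hx
      simp [sepOps, hok.2 e he]
    rw [h1, h2, add_zero]
  · -- some term is `⊤`
    rw [WithTop.add_eq_top]
    simp only [OK, not_and_or, not_forall, exists_prop] at hok
    rcases hok with ⟨v, hv, hbad⟩ | ⟨e, he, hbad⟩
    · left
      rw [list_sum_eq_top_iff]
      refine List.mem_map.2 ⟨_, List.mem_range.2 hv, ?_⟩
      simp [sepOps, hbad]
    · right
      rw [list_sum_eq_top_iff]
      refine List.mem_map.2 ⟨_, he, ?_⟩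
      simp [sepOps, hbad]

/-- **`sepMin` is the minimum cost over the labelings** (values `< 3` on the vertices, `0`
elsewhere), for valid static data. [cite: Dechter1999, §6 (bucket elimination solves min-sum)] -/
theorem sepMin_eq_inf {C : SepCtx} (hC : C.Valid) (S : List ℕ) (forced : List (ℕ × ℕ)) :
    sepMin C S forced = (assignments (Finset.range C.nv) 3).inf (costOf C S forced) := by
  classical
  unfold sepMin
  rw [dpValue_eq_netValue hC.td (by norm_num) ?_ ?_ hC.cap, netValue, Finset.untrop_sum']
  · congr 1
    funext a
    simp only [Function.comp_apply, List.untrop_prod, List.map_map]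
    rfl
  · -- every factor is housed
    intro φ hφ
    rw [homeOf_lt_length_iff]
    rcases List.mem_append.1 hφ with h | h
    · obtain ⟨v, hv, rfl⟩ := List.mem_map.1 h
      obtain ⟨t, ht, hvt⟩ := hC.td.cover v (by simpa using hv)
      exact ⟨C.bags[t], List.getElem_mem ht, fun w hw => by
        simp only [sepOps, List.mem_singleton] at hw; rw [hw, ← bagOf_eq_getElem ht]; exact hvt⟩
    · obtain ⟨e, he, rfl⟩ := List.mem_map.1 h
      obtain ⟨-, -, t, ht, h1, h2⟩ := hC.edges e he
      refine ⟨C.bags[t], List.getElem_mem ht, fun w hw => ?_⟩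
      simp only [sepOps, List.mem_cons, List.not_mem_nil, or_false] at hw
      rcases hw with rfl | rfl
      · rw [← bagOf_eq_getElem ht]; exact h1
      · rw [← bagOf_eq_getElem ht]; exact h2
  · -- entries depend on the scope only
    intro φ _ a b hab
    cases φ with
    | un v => simp only [sepOps] at hab ⊢; rw [hab v (List.mem_singleton_self v)]
    | bin u v =>
      simp only [sepOps] at hab ⊢
      rw [hab u (by simp), hab v (by simp)]

/-- The zero labeling is a labeling. [folklore] -/
theorem zero_mem_assignments (D : Finset ℕ) {d : ℕ} (hd : 0 < d) : (fun _ => 0) ∈ assignments D d :=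
  mem_assignments.2 ⟨fun _ _ => hd, fun _ _ => rfl⟩

/-- **The minimum is attained.** [folklore] -/
theorem exists_costOf_eq_sepMin {C : SepCtx} (hC : C.Valid) (S : List ℕ) (forced : List (ℕ × ℕ)) :
    ∃ a ∈ assignments (Finset.range C.nv) 3, costOf C S forced a = sepMin C S forced := by
  rw [sepMin_eq_inf hC]
  obtain ⟨a, ha, h⟩ := Finset.exists_mem_eq_inf (assignments (Finset.range C.nv) 3)
    ⟨_, zero_mem_assignments _ (by norm_num)⟩ (costOf C S forced)
  exact ⟨a, ha, h.symm⟩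

/-- **The minimum is a lower bound.** [folklore] -/
theorem sepMin_le_costOf {C : SepCtx} (hC : C.Valid) (S : List ℕ) (forced : List (ℕ × ℕ)) {a : ℕ → ℕ}
    (ha : a ∈ assignments (Finset.range C.nv) 3) : sepMin C S forced ≤ costOf C S forced a := by
  rw [sepMin_eq_inf hC]; exact Finset.inf_le ha

/-! ### Forcing one more label -/

/-- Forcing one more label keeps the separator count and conjoins one constraint. [folklore] -/
theorem ok_append_iff (C : SepCtx) (S : List ℕ) (forced : List (ℕ × ℕ)) (v l : ℕ) (a : ℕ → ℕ) :
    OK C S (forced ++ [(v, l)]) a ↔ OK C S forced a ∧ (v < C.nv → a v = l) := by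
  simp only [OK, UnOK, List.mem_append, List.mem_singleton]
  constructor
  · rintro ⟨h1, h2⟩
    exact ⟨⟨fun w hw q hq hqw => h1 w hw q (Or.inl hq) hqw, h2⟩, fun hv => h1 v hv (v, l) (Or.inr rfl) rfl⟩
  · rintro ⟨⟨h1, h2⟩, h3⟩
    refine ⟨fun w hw q hq hqw => ?_, h2⟩
    rcases hq with hq | rfl
    · exact h1 w hw q hq hqw
    · simp only at hqw
      subst hqw
      exact h3 hw

/-- The cost under one more forced label. [folklore] -/
theorem costOf_append (C : SepCtx) (S : List ℕ) (forced : List (ℕ × ℕ)) (v l : ℕ) (a : ℕ → ℕ) :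
    costOf C S (forced ++ [(v, l)]) a = if v < C.nv → a v = l then costOf C S forced a else ⊤ := by
  classical
  rw [costOf_eq, costOf_eq]
  by_cases h : v < C.nv → a v = l
  · by_cases hok : OK C S forced a
    · rw [if_pos ((ok_append_iff C S forced v l a).2 ⟨hok, h⟩), if_pos h, if_pos hok]
    · rw [if_neg (fun h' => hok ((ok_append_iff C S forced v l a).1 h').1), if_pos h, if_neg hok]
  · rw [if_neg (fun h' => h ((ok_append_iff C S forced v l a).1 h').2), if_neg h]

/-- **Forcing cannot lower the minimum.** [folklore] -/
theorem sepMin_le_sepMin_append {C : SepCtx} (hC : C.Valid) (S : List ℕ) (forced : List (ℕ × ℕ)) (v l : ℕ) :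
    sepMin C S forced ≤ sepMin C S (forced ++ [(v, l)]) := by
  obtain ⟨a, ha, h⟩ := exists_costOf_eq_sepMin hC S (forced ++ [(v, l)])
  rw [← h, costOf_append]
  split_ifs with hv
  · exact sepMin_le_costOf hC S forced ha
  · exact le_top

/-- **Some label of `v` keeps the minimum** (the label of `v` in an optimal labeling). [folklore] -/
theorem exists_sepMin_append_le {C : SepCtx} (hC : C.Valid) (S : List ℕ) (forced : List (ℕ × ℕ)) (v : ℕ) :
    ∃ l, l < 3 ∧ sepMin C S (forced ++ [(v, l)]) ≤ sepMin C S forced := by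
  obtain ⟨a, ha, h⟩ := exists_costOf_eq_sepMin hC S forced
  have hav : a v < 3 := by
    rcases mem_assignments.1 ha with ⟨h1, h2⟩
    by_cases hv : v ∈ Finset.range C.nv
    · exact h1 v hv
    · rw [h2 v hv]; norm_num
  refine ⟨a v, hav, ?_⟩
  calc sepMin C S (forced ++ [(v, a v)]) ≤ costOf C S (forced ++ [(v, a v)]) a := sepMin_le_costOf hC S _ ha
    _ = costOf C S forced a := by rw [costOf_append, if_pos fun _ => rfl]
    _ = sepMin C S forced := h

/-! ### The oracle: threshold and self-reduction -/

/-- **Choosing the label of `v`**: the first label keeping the minimum `m` (the third if the first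
two do not), recorded both as a forced pair and in the label list. [cite: CyganEtAl2015, Thm 7.18 (the separator is output, not only its size)] -/
noncomputable def chooseLabel (C : SepCtx) (S : List ℕ) (m : WithTop ℕ) (acc : List (ℕ × ℕ) × List ℕ) (v : ℕ) :
    List (ℕ × ℕ) × List ℕ :=
  if sepMin C S (acc.1 ++ [(v, 0)]) ≤ m then (acc.1 ++ [(v, 0)], acc.2 ++ [0])
  else if sepMin C S (acc.1 ++ [(v, 1)]) ≤ m then (acc.1 ++ [(v, 1)], acc.2 ++ [1])
  else (acc.1 ++ [(v, 2)], acc.2 ++ [2])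

/-- **Extending the forced labels to all of `S`**, vertex by vertex. [folklore] -/
noncomputable def extendAll (C : SepCtx) (S : List ℕ) (m : WithTop ℕ) (forced : List (ℕ × ℕ)) : List (ℕ × ℕ) × List ℕ :=
  S.foldl (chooseLabel C S m) (forced, [])

/-- **The separator oracle**: if the minimum cost is at most `k + 1`, the labels of `S` of an
optimal labeling (aligned with `S`), else nothing. [cite: CyganEtAl2015, Thm 7.18 (the separation step)] -/
noncomputable def sepOracle (C : SepCtx) (k : ℕ) : List ℕ → List (ℕ × ℕ) → Option (List ℕ) := fun S forced =>
  if sepMin C S forced ≤ (k + 1 : ℕ) then some (extendAll C S (sepMin C S forced) forced).2 else none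

/-- **The invariant of the self-reduction** along a prefix `S₁` of `S`: the accumulator is
(`forced ++ S₁.zip labels`, `labels`), with `|labels| = |S₁|`, labels `≤ 2`, and the minimum
unchanged. [folklore] -/
theorem extend_invariant {C : SepCtx} (hC : C.Valid) (S : List ℕ) (forced : List (ℕ × ℕ)) :
    ∀ (S₂ S₁ : List ℕ) (acc : List (ℕ × ℕ) × List ℕ),
      acc.1 = forced ++ S₁.zip acc.2 → acc.2.length = S₁.length → (∀ x ∈ acc.2, x ≤ 2) →
      sepMin C S acc.1 = sepMin C S forced →
      (S₂.foldl (chooseLabel C S (sepMin C S forced)) acc).1 =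
          forced ++ (S₁ ++ S₂).zip (S₂.foldl (chooseLabel C S (sepMin C S forced)) acc).2 ∧
        (S₂.foldl (chooseLabel C S (sepMin C S forced)) acc).2.length = (S₁ ++ S₂).length ∧
        (∀ x ∈ (S₂.foldl (chooseLabel C S (sepMin C S forced)) acc).2, x ≤ 2) ∧
        sepMin C S (S₂.foldl (chooseLabel C S (sepMin C S forced)) acc).1 = sepMin C S forced
  | [], S₁, acc, h1, h2, h3, h4 => by
    simp only [List.foldl_nil, List.append_nil]
    exact ⟨h1, h2, h3, h4⟩
  | v :: S₂, S₁, acc, h1, h2, h3, h4 => by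
    -- one step of `chooseLabel`
    have hstep : ∃ l, l ≤ 2 ∧ chooseLabel C S (sepMin C S forced) acc v = (acc.1 ++ [(v, l)], acc.2 ++ [l]) ∧
        sepMin C S (acc.1 ++ [(v, l)]) = sepMin C S forced := by
      obtain ⟨l₀, hl₀, hle⟩ := exists_sepMin_append_le hC S acc.1 v
      rw [h4] at hle
      have hge : ∀ l, sepMin C S forced ≤ sepMin C S (acc.1 ++ [(v, l)]) := fun l =>
        h4 ▸ sepMin_le_sepMin_append hC S acc.1 v l
      unfold chooseLabel
      by_cases h0 : sepMin C S (acc.1 ++ [(v, 0)]) ≤ sepMin C S forced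
      · exact ⟨0, by norm_num, by rw [if_pos h0], le_antisymm h0 (hge 0)⟩
      · by_cases h1' : sepMin C S (acc.1 ++ [(v, 1)]) ≤ sepMin C S forced
        · exact ⟨1, by norm_num, by rw [if_neg h0, if_pos h1'], le_antisymm h1' (hge 1)⟩
        · refine ⟨2, le_rfl, by rw [if_neg h0, if_neg h1'], le_antisymm ?_ (hge 2)⟩
          -- the good label is neither `0` nor `1`
          have : l₀ = 2 := by
            rcases (show l₀ = 0 ∨ l₀ = 1 ∨ l₀ = 2 by omega) with rfl | rfl | rfl
            · exact absurd hle h0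
            · exact absurd hle h1'
            · rfl
          rw [this] at hle; exact hle
    obtain ⟨l, hl2, hch, hml⟩ := hstep
    have ih := extend_invariant hC S forced S₂ (S₁ ++ [v]) (chooseLabel C S (sepMin C S forced) acc v)
      (by rw [hch, h1]; simp [List.zip_append h2.symm])
      (by rw [hch]; simp [h2]) (by
        rw [hch]; intro x hx
        rcases List.mem_append.1 hx with hx | hx
        · exact h3 x hx
        · simp only [List.mem_singleton] at hx; omega) (by rw [hch]; exact hml)
    have hS : S₁ ++ v :: S₂ = S₁ ++ [v] ++ S₂ := by simp
    rw [List.foldl_cons, hS]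
    exact ih

/-- **What the oracle returns**: labels aligned with `S`, all `≤ 2`, whose forcing keeps the
minimum, which is at most `k + 1`. [folklore] -/
theorem sepOracle_eq_some {C : SepCtx} (hC : C.Valid) {k : ℕ} {S : List ℕ} {forced : List (ℕ × ℕ)} {lab : List ℕ}
    (h : sepOracle C k S forced = some lab) :
    lab.length = S.length ∧ (∀ x ∈ lab, x ≤ 2) ∧ sepMin C S (forced ++ S.zip lab) = sepMin C S forced ∧
      sepMin C S forced ≤ (k + 1 : ℕ) := by
  unfold sepOracle at h
  split_ifs at h with hle
  simp only [Option.some.injEq] at h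
  obtain ⟨h1, h2, h3, h4⟩ := extend_invariant hC S forced S [] (forced, []) (by simp) rfl (by simp) rfl
  simp only [List.nil_append] at h1 h2
  rw [extendAll] at h
  rw [← h]
  refine ⟨h2, h3, ?_, hle⟩
  rw [← h1]; exact h4

/-! ### Soundness and completeness -/

/-- The sum of an indicator along a list is the number of elements satisfying it. [folklore] -/
theorem sum_map_ite_eq_length_filter (l : List ℕ) (p : ℕ → Prop) [DecidablePred p] :
    (l.map fun v => if p v then 1 else 0).sum = (l.filter fun v => decide (p v)).length := by
  induction l with
  | nil => simp
  | cons v l ih => by_cases hv : p v <;> simp [hv, ih, Nat.add_comm]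

/-- Counting over the vertex range restricted to `S` is counting over `S` (for `S` without
repetition inside the range). [folklore] -/
theorem natCost_eq_length_filter (C : SepCtx) {S : List ℕ} (hS : S.Nodup) (hSnv : ∀ v ∈ S, v < C.nv) (a : ℕ → ℕ) :
    natCost C S a = (S.filter fun v => decide (a v = 1)).length := by
  classical
  unfold natCost unNat
  rw [sum_map_ite_eq_length_filter, ← List.toFinset_card_of_nodup ((List.nodup_range).filter _),
    ← List.toFinset_card_of_nodup (hS.filter _), List.toFinset_filter, List.toFinset_filter]
  congr 1
  ext v
  simp only [Finset.mem_filter, List.mem_toFinset, List.mem_range, decide_eq_true_eq]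
  constructor
  · rintro ⟨-, hvS, h1⟩; exact ⟨hvS, h1⟩
  · rintro ⟨hvS, h1⟩; exact ⟨hSnv v hvS, hvS, h1⟩

/-- **Soundness of the separator oracle** (for valid static data): a returned labeling of `S`
extends the forced labels, has labels `≤ 2`, at most `k + 1` separator vertices in `S` and no
edge of `S` from side `0` to side `2`. [cite: CyganEtAl2015, Thm 7.18 (the separation step)] -/
theorem sepOracle_sound {C : SepCtx} (hC : C.Valid) (k : ℕ) :
    OracleSound (edgeRel C.edges) k (List.range C.nv) (sepOracle C k) := by
  intro S forced lab hS hSS₀ h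
  have hSnv : ∀ v ∈ S, v < C.nv := fun v hv => List.mem_range.1 (hSS₀ v hv)
  obtain ⟨hlen, hlab2, hkeep, hle⟩ := sepOracle_eq_some hC h
  set f' := forced ++ S.zip lab with hf'
  obtain ⟨a, ha, hcost⟩ := exists_costOf_eq_sepMin hC S f'
  rw [hkeep] at hcost
  -- the optimal labeling satisfies all constraints and has at most `k + 1` separator vertices
  rw [costOf_eq] at hcost
  have hok : OK C S f' a := by
    by_contra hno; rw [if_neg hno] at hcost; rw [← hcost] at hle; exact absurd hle (by simp)
  rw [if_pos hok] at hcost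
  have hnat : natCost C S a ≤ k + 1 := by
    have := hcost ▸ hle; exact_mod_cast this
  -- the returned labels are the labels of `a` on `S`
  have hA : ∀ (i : ℕ) (hi : i < S.length), a S[i] = lab[i]'(hlen ▸ hi) := by
    intro i hi
    have hq : (S[i], lab[i]'(hlen ▸ hi)) ∈ f' := by
      refine List.mem_append_right _ ?_
      have hiz : i < (S.zip lab).length := by simp [hi, hlen]
      have := List.getElem_mem hiz
      rwa [List.getElem_zip] at this
    exact hok.1 _ (hSnv _ (List.getElem_mem hi)) _ hq rfl
  have hB : ∀ v ∈ S, labelOf S lab v = a v := by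
    intro v hv
    obtain ⟨i, hi, rfl⟩ := List.mem_iff_getElem.1 hv
    rw [labelOf_getElem S lab hS hi (hlen ▸ hi), hA i hi]
  refine ⟨hlen, hlab2, fun q hq hqS => ?_, ?_, fun u hu v hv huv hu0 hv2 => ?_⟩
  · rw [hB _ hqS]
    exact hok.1 _ (hSnv _ hqS) q (List.mem_append_left _ hq) rfl
  · have : side S lab 1 = S.filter fun v => decide (a v = 1) := by
      unfold side; exact List.filter_congr fun v hv => by rw [hB v hv]
    rw [this, ← natCost_eq_length_filter C hS hSnv a]
    exact hnat
  · rw [hB u hu] at hu0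
    rw [hB v hv] at hv2
    rcases huv with he | he
    · exact hok.2 _ he ⟨hu, hv, Or.inl ⟨hu0, hv2⟩⟩
    · exact hok.2 _ he ⟨hv, hu, Or.inr ⟨hv2, hu0⟩⟩

/-- **Completeness of the separator oracle** (for valid static data): if some labeling with labels
`≤ 2` extends the forced labels, has at most `k + 1` separator vertices in `S` and no edge of `S`
from side `0` to side `2`, the oracle answers. [cite: CyganEtAl2015, Thm 7.18 (the separation step)] -/
theorem sepOracle_complete {C : SepCtx} (hC : C.Valid) (k : ℕ) :
    OracleComplete (edgeRel C.edges) k (List.range C.nv) (sepOracle C k) := by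
  rintro S forced hS hSS₀ hkeys ⟨ℓ, hf, hl2, h1, h02⟩
  have hSnv : ∀ v ∈ S, v < C.nv := fun v hv => List.mem_range.1 (hSS₀ v hv)
  set a : ℕ → ℕ := fun v => if v < C.nv then ℓ v else 0 with ha_def
  have haS : ∀ v ∈ S, a v = ℓ v := fun v hv => by simp [ha_def, hSnv v hv]
  have ha : a ∈ assignments (Finset.range C.nv) 3 := by
    refine mem_assignments.2 ⟨fun v hv => ?_, fun v hv => ?_⟩
    · have := hl2 v
      simp only [ha_def, if_pos (Finset.mem_range.1 hv)]
      omega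
    · have : ¬ v < C.nv := by simpa using hv
      simp [ha_def, this]
  have hok : OK C S forced a := by
    refine ⟨fun v hv q hq hqv => ?_, fun e he hbad => ?_⟩
    · simp only [ha_def, if_pos hv]
      rw [← hqv]; exact hf q hq
    · obtain ⟨h1nv, h2nv, -⟩ := hC.edges e he
      simp only [ha_def, if_pos h1nv, if_pos h2nv] at hbad
      obtain ⟨hu, hv, hl⟩ := hbad
      rcases hl with ⟨hu0, hv2⟩ | ⟨hu2, hv0⟩
      · exact h02 e.1 hu e.2 hv (Or.inl he) hu0 hv2
      · exact h02 e.2 hv e.1 hu (Or.inr he) hv0 hu2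
  have hcost : costOf C S forced a ≤ (k + 1 : ℕ) := by
    rw [costOf_eq, if_pos hok, natCost_eq_length_filter C hS hSnv]
    have : (S.filter fun v => decide (a v = 1)) = S.filter fun v => decide (ℓ v = 1) :=
      List.filter_congr fun v hv => by rw [haS v hv]
    rw [this]
    exact_mod_cast h1
  have hmin : sepMin C S forced ≤ (k + 1 : ℕ) := (sepMin_le_costOf hC S forced ha).trans hcost
  unfold sepOracle
  rw [if_pos hmin]
  rfl

end ListTD

end Literature.Combinatorics.SimpleGraph
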